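import Mathlib
import Summits.Ventures.PercRepro2.Defs

/-!
# The arithmetic of the type calculus (blind cell PercRepro2, p3 g42, 2026-08-30;
`proofs/P3-POCKETRK.md` §10⁶ (d))

Abstract form of the final count: over a finite index set (the cluster colourings), each index
`i` has an admissibility `A i`, a class (`c0`: no `Y`-link, `crs`: `r ~ s`, `crd`: `d ~ r` only,
`csd`: `d ~ s` only, `crsd`: both), a `W`-link `w i` and a dead end `dl i`; five symbol functions
`X Y X' Zr Zs : Prop → ℤ` (the outside sums, as functions of the dead-end proposition) are
non-positive.  If `f i` is the class expression of `i`
(`Y − [w]X`, `(1 − [w])X`, `Zr − [w]X'`, `Zs − [w]X'`, `(1 − [w])X'`) and the counts satisfy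
`#{c0, w, dl} ≤ #{crs, ¬w, dl}` and `#{crd, w, dl} + #{csd, w, dl} ≤ #{crsd, ¬w, dl}` for
`dl` true and for `dl` false, then `Σ_i f i ≤ 0` (`sum_classes_nonpos_p3`).  Own work; std
axioms.
-/

namespace Summit.Ventures.PercRepro2

namespace NoPocket

open Finset Classical

variable {ι : Type*} [Fintype ι]

/-- Splitting a sum of `c i · F (dl i)` by the truth value of `dl i`. -/
lemma sum_mul_prop_split_p3 (dl : ι → Prop) (c : ι → ℤ) (F : Prop → ℤ) :
    (∑ i, c i * F (dl i)) =
      (∑ i, if dl i then c i else 0) * F True + (∑ i, if dl i then 0 else c i) * F False := by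
  rw [Finset.sum_mul, Finset.sum_mul, ← Finset.sum_add_distrib]
  refine Finset.sum_congr rfl fun i _ => ?_
  by_cases h : dl i
  · rw [if_pos h, if_pos h, congrArg F (eq_true h)]; ring
  · rw [if_neg h, if_neg h, congrArg F (eq_false h)]; ring

/-- **The arithmetic of the type calculus.** -/
theorem sum_classes_nonpos_p3 (A c0 crs crd csd crsd w dl : ι → Prop)
    (X Y X' Zr Zs : Prop → ℤ)
    (hX : ∀ δ, X δ ≤ 0) (hY : ∀ δ, Y δ ≤ 0) (hX' : ∀ δ, X' δ ≤ 0) (hZr : ∀ δ, Zr δ ≤ 0)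
    (hZs : ∀ δ, Zs δ ≤ 0)
    (f : ι → ℤ)
    (hf : ∀ i, f i =
      (if A i ∧ c0 i then Y (dl i) - (if w i then 1 else 0) * X (dl i) else 0) +
      (if A i ∧ crs i then X (dl i) - (if w i then 1 else 0) * X (dl i) else 0) +
      (if A i ∧ crd i then Zr (dl i) - (if w i then 1 else 0) * X' (dl i) else 0) +
      (if A i ∧ csd i then Zs (dl i) - (if w i then 1 else 0) * X' (dl i) else 0) +
      (if A i ∧ crsd i then X' (dl i) - (if w i then 1 else 0) * X' (dl i) else 0))
    (hC1t : (∑ i, if A i ∧ c0 i ∧ w i ∧ dl i then (1 : ℤ) else 0) ≤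
      ∑ i, if A i ∧ crs i ∧ ¬ w i ∧ dl i then (1 : ℤ) else 0)
    (hC1f : (∑ i, if A i ∧ c0 i ∧ w i ∧ ¬ dl i then (1 : ℤ) else 0) ≤
      ∑ i, if A i ∧ crs i ∧ ¬ w i ∧ ¬ dl i then (1 : ℤ) else 0)
    (hC2t : (∑ i, if A i ∧ crd i ∧ w i ∧ dl i then (1 : ℤ) else 0) +
        (∑ i, if A i ∧ csd i ∧ w i ∧ dl i then (1 : ℤ) else 0) ≤
      ∑ i, if A i ∧ crsd i ∧ ¬ w i ∧ dl i then (1 : ℤ) else 0)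
    (hC2f : (∑ i, if A i ∧ crd i ∧ w i ∧ ¬ dl i then (1 : ℤ) else 0) +
        (∑ i, if A i ∧ csd i ∧ w i ∧ ¬ dl i then (1 : ℤ) else 0) ≤
      ∑ i, if A i ∧ crsd i ∧ ¬ w i ∧ ¬ dl i then (1 : ℤ) else 0) :
    (∑ i, f i) ≤ 0 := by
  -- the coefficient of `X (dl i)` and of `X' (dl i)` at `i`
  set cX : ι → ℤ := fun i => (if A i ∧ crs i ∧ ¬ w i then 1 else 0) -
    (if A i ∧ c0 i ∧ w i then 1 else 0) with hcX
  set cX' : ι → ℤ := fun i => (if A i ∧ crsd i ∧ ¬ w i then 1 else 0) -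
    (if A i ∧ crd i ∧ w i then 1 else 0) - (if A i ∧ csd i ∧ w i then 1 else 0) with hcX'
  -- the pointwise regrouping
  have hpt : ∀ i, f i = (if A i ∧ c0 i then Y (dl i) else 0) + (if A i ∧ crd i then Zr (dl i) else 0) +
      (if A i ∧ csd i then Zs (dl i) else 0) + cX i * X (dl i) + cX' i * X' (dl i) := by
    intro i
    rw [hf i]
    simp only [hcX, hcX']
    by_cases hA : A i <;> by_cases h0 : c0 i <;> by_cases hrs : crs i <;> by_cases hrd : crd i <;>
      by_cases hsd : csd i <;> by_cases hrsd : crsd i <;> by_cases hw : w i <;>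
      simp [hA, h0, hrs, hrd, hsd, hrsd, hw] <;> ring
  rw [Finset.sum_congr rfl fun i _ => hpt i]
  simp only [Finset.sum_add_distrib]
  have h1 : (∑ i, if A i ∧ c0 i then Y (dl i) else 0) ≤ 0 :=
    Finset.sum_nonpos fun i _ => by split_ifs; exacts [hY _, le_refl 0]
  have h2 : (∑ i, if A i ∧ crd i then Zr (dl i) else 0) ≤ 0 :=
    Finset.sum_nonpos fun i _ => by split_ifs; exacts [hZr _, le_refl 0]
  have h3 : (∑ i, if A i ∧ csd i then Zs (dl i) else 0) ≤ 0 :=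
    Finset.sum_nonpos fun i _ => by split_ifs; exacts [hZs _, le_refl 0]
  -- the `X` part: split by the dead end and use the counts
  have hXs : (∑ i, cX i * X (dl i)) ≤ 0 := by
    rw [sum_mul_prop_split_p3]
    have e1 : (∑ i, if dl i then cX i else 0) =
        (∑ i, if A i ∧ crs i ∧ ¬ w i ∧ dl i then (1 : ℤ) else 0) -
        (∑ i, if A i ∧ c0 i ∧ w i ∧ dl i then (1 : ℤ) else 0) := by
      rw [← Finset.sum_sub_distrib]
      refine Finset.sum_congr rfl fun i _ => ?_
      simp only [hcX]
      by_cases hA : A i <;> by_cases h0 : c0 i <;> by_cases hrs : crs i <;> by_cases hw : w i <;>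
        by_cases hd : dl i <;> simp [hA, h0, hrs, hw, hd]
    have e2 : (∑ i, if dl i then 0 else cX i) =
        (∑ i, if A i ∧ crs i ∧ ¬ w i ∧ ¬ dl i then (1 : ℤ) else 0) -
        (∑ i, if A i ∧ c0 i ∧ w i ∧ ¬ dl i then (1 : ℤ) else 0) := by
      rw [← Finset.sum_sub_distrib]
      refine Finset.sum_congr rfl fun i _ => ?_
      simp only [hcX]
      by_cases hA : A i <;> by_cases h0 : c0 i <;> by_cases hrs : crs i <;> by_cases hw : w i <;>
        by_cases hd : dl i <;> simp [hA, h0, hrs, hw, hd]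
    rw [e1, e2]
    have := hX True
    have := hX False
    nlinarith
  have hX's : (∑ i, cX' i * X' (dl i)) ≤ 0 := by
    rw [sum_mul_prop_split_p3]
    have e1 : (∑ i, if dl i then cX' i else 0) =
        (∑ i, if A i ∧ crsd i ∧ ¬ w i ∧ dl i then (1 : ℤ) else 0) -
        (∑ i, if A i ∧ crd i ∧ w i ∧ dl i then (1 : ℤ) else 0) -
        (∑ i, if A i ∧ csd i ∧ w i ∧ dl i then (1 : ℤ) else 0) := by
      rw [← Finset.sum_sub_distrib, ← Finset.sum_sub_distrib]
      refine Finset.sum_congr rfl fun i _ => ?_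
      simp only [hcX']
      by_cases hA : A i <;> by_cases hrd : crd i <;> by_cases hsd : csd i <;>
        by_cases hrsd : crsd i <;> by_cases hw : w i <;> by_cases hd : dl i <;>
        simp [hA, hrd, hsd, hrsd, hw, hd]
    have e2 : (∑ i, if dl i then 0 else cX' i) =
        (∑ i, if A i ∧ crsd i ∧ ¬ w i ∧ ¬ dl i then (1 : ℤ) else 0) -
        (∑ i, if A i ∧ crd i ∧ w i ∧ ¬ dl i then (1 : ℤ) else 0) -
        (∑ i, if A i ∧ csd i ∧ w i ∧ ¬ dl i then (1 : ℤ) else 0) := by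
      rw [← Finset.sum_sub_distrib, ← Finset.sum_sub_distrib]
      refine Finset.sum_congr rfl fun i _ => ?_
      simp only [hcX']
      by_cases hA : A i <;> by_cases hrd : crd i <;> by_cases hsd : csd i <;>
        by_cases hrsd : crsd i <;> by_cases hw : w i <;> by_cases hd : dl i <;>
        simp [hA, hrd, hsd, hrsd, hw, hd]
    rw [e1, e2]
    have := hX' True
    have := hX' False
    nlinarith
  linarith

end NoPocket

end Summit.Ventures.PercRepro2
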